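import Summits.Ventures.Crystal3D.Theorems.StickyWulffConstantGenericWallFloorRayAlignedCriteria
import HarnessLib

/-!
# Word length bookkeeping: short words are co-axial pairs, coincidence levels bound the `Σ3ⁿ` level

HONEST FRAMING. Part of the venture `Summits/Ventures/Crystal3D` (cell `crystal3d-full`), helper `--supports` the
crux `GenericWallFloor` (stmt-Ventures-19480) of `route-Ventures-StickyWulffConstant`, registered line `WallLedgerG`,
open stub `stub_twoSlabAdhesion`.  Fifth file of the WORD HALF of G-CL (cf-p1 DECISION (l) item (3): «(i) |κ| ≤ 1 ⇒
co-axial; (iii) level bookkeeping»).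

* **`coaxial_of_word_length_le_one`** — if `A₂·Λ₀ = (wordFrame A₁ κ)·Λ₀` for a word of at most ONE unit model menu
  letter, the affine pair `(A₁, t₁), (A₂, t₂)` is co-axial for all translations (equal lattices, or twins across a menu
  normal: `exists_frame_of_menu`, `coaxial_of_common_frame`); **`two_le_length_of_not_coaxial`** — so on the
  non-co-axial Core every relating word has `|κ| ≥ 2`.
* **`exists_reduced_word_of_coaxial_wordFrames_length`** — the reduced word relating the bases of two co-axial word frames
  `wordFrame A₁ α`, `wordFrame A₂ β` has length `≤ |α| + |β| + 1`.
* **`exists_reduced_word_of_coaxial_levels`** and the base cases `_base_left` / `_base_right` — for a co-axial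
  coincidence between LEVEL `k₁` of a forced ray of grain 1 and LEVEL `k₂` of a forced ray of grain 2 the reduced word has
  `|κ| ≤ k₁ + k₂ + 3`; between the base `A₁` and level `k₂`: `|κ| ≤ k₂ + 2`; level `k₁` and the base `A₂`: `|κ| ≤ k₁ + 2`
  (base against base: `|κ| ≤ 1`, a co-axial pair).  With `|κ| = n` the pair is `Σ3ⁿ`-related at most: level `0/0`
  coincidences give at most `Σ27`, base/level-0 at most `Σ9`.

WHAT THIS IS NOT: not the stub; no counting; F-C1 not moved.
-/

noncomputable section

namespace Summit.Ventures.Crystal3D.Theorems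

open Summit.Ventures.Crystal3D Finset
open Literature.MathematicalPhysics.StatisticalMechanics (fccStacking barlowStacking IsHaggSeq)
open scoped InnerProductSpace

/-! ### Short words are co-axial pairs -/

/-- **A word of at most one letter relates CO-AXIAL lattices.**  If `A₂·Λ₀ = (wordFrame A₁ κ)·Λ₀` with `|κ| ≤ 1` (unit model
menu letters), then for all translations the affine pair is co-axial. -/
theorem coaxial_of_word_length_le_one {A₁ A₂ : EuclideanSpace ℝ (Fin 3) ≃ₗᵢ[ℝ] EuclideanSpace ℝ (Fin 3)}
    {κ : List (EuclideanSpace ℝ (Fin 3))}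
    (hκl : ∀ μ ∈ κ, ‖μ‖ = 1 ∧
      ∀ w ∈ fccSlots, ⟪w, μ⟫_ℝ = 0 ∨ ⟪w, μ⟫_ℝ = Real.sqrt (2 / 3) ∨ ⟪w, μ⟫_ℝ = -Real.sqrt (2 / 3))
    (hκ1 : κ.length ≤ 1)
    (hA₂ : A₂ '' fccStacking 1 (Real.sqrt (2 / 3)) = (wordFrame A₁ κ) '' fccStacking 1 (Real.sqrt (2 / 3)))
    (t₁ t₂ : EuclideanSpace ℝ (Fin 3)) :
    ∃ (L : EuclideanSpace ℝ (Fin 3) ≃ₗᵢ[ℝ] EuclideanSpace ℝ (Fin 3))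
      (s₁ s₂ : EuclideanSpace ℝ (Fin 3)) (σ σ' : ℤ → ℤ), IsHaggSeq σ ∧ IsHaggSeq σ' ∧
      (fun p => A₁ p + t₁) '' fccStacking 1 (Real.sqrt (2 / 3)) ⊆
        (fun p => L p + s₁) '' barlowStacking 1 (Real.sqrt (2 / 3)) σ ∧
      (fun p => A₂ p + t₂) '' fccStacking 1 (Real.sqrt (2 / 3)) ⊆
        (fun p => L p + s₂) '' barlowStacking 1 (Real.sqrt (2 / 3)) σ' := by
  match κ, hκl, hκ1, hA₂ with
  | [], _, _, hA₂ =>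
    exact coaxial_of_common_frame A₁ A₂ A₁ t₁ t₂ (Or.inl rfl) (Or.inl hA₂)
  | [μ], hκl, _, hA₂ =>
    obtain ⟨hμ1, hμm⟩ := hκl μ (by simp)
    have hm : ‖A₁ μ‖ = 1 := by rw [LinearIsometryEquiv.norm_map, hμ1]
    have hmenu := menu_frame_of_model A₁ hμm
    rw [wordFrame_singleton_eq_twinFrame A₁ hμ1] at hA₂
    obtain ⟨L, hL, hLe⟩ := exists_frame_of_menu A₁ hm hmenu
    exact coaxial_of_common_frame A₁ A₂ L t₁ t₂ (Or.inl hL.symm)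
      (Or.inr (twin_image_eq_frame_negConst hm hL hLe hA₂))

/-- **On the non-co-axial Core every relating word has at least two letters.** -/
theorem two_le_length_of_not_coaxial {A₁ A₂ : EuclideanSpace ℝ (Fin 3) ≃ₗᵢ[ℝ] EuclideanSpace ℝ (Fin 3)}
    {t₁ t₂ : EuclideanSpace ℝ (Fin 3)}
    (hnc : ¬ ∃ (L : EuclideanSpace ℝ (Fin 3) ≃ₗᵢ[ℝ] EuclideanSpace ℝ (Fin 3))
      (s₁ s₂ : EuclideanSpace ℝ (Fin 3)) (σ σ' : ℤ → ℤ), IsHaggSeq σ ∧ IsHaggSeq σ' ∧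
      (fun p => A₁ p + t₁) '' fccStacking 1 (Real.sqrt (2 / 3)) ⊆
        (fun p => L p + s₁) '' barlowStacking 1 (Real.sqrt (2 / 3)) σ ∧
      (fun p => A₂ p + t₂) '' fccStacking 1 (Real.sqrt (2 / 3)) ⊆
        (fun p => L p + s₂) '' barlowStacking 1 (Real.sqrt (2 / 3)) σ')
    {κ : List (EuclideanSpace ℝ (Fin 3))}
    (hκl : ∀ μ ∈ κ, ‖μ‖ = 1 ∧
      ∀ w ∈ fccSlots, ⟪w, μ⟫_ℝ = 0 ∨ ⟪w, μ⟫_ℝ = Real.sqrt (2 / 3) ∨ ⟪w, μ⟫_ℝ = -Real.sqrt (2 / 3))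
    (hA₂ : A₂ '' fccStacking 1 (Real.sqrt (2 / 3)) = (wordFrame A₁ κ) '' fccStacking 1 (Real.sqrt (2 / 3))) :
    2 ≤ κ.length := by
  by_contra h
  exact hnc (coaxial_of_word_length_le_one hκl (by omega) hA₂ t₁ t₂)

/-! ### Coincidence levels bound the word length -/

/-- **The reduced word of two co-axial word frames is not longer than `|α| + |β| + 1`.** -/
theorem exists_reduced_word_of_coaxial_wordFrames_length
    {A₁ A₂ F₁ F₂ : EuclideanSpace ℝ (Fin 3) ≃ₗᵢ[ℝ] EuclideanSpace ℝ (Fin 3)} {α β : List (EuclideanSpace ℝ (Fin 3))}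
    (hF₁ : F₁ = wordFrame A₁ α) (hF₂ : F₂ = wordFrame A₂ β)
    (hα : ∀ μ ∈ α, ‖μ‖ = 1 ∧
      ∀ w ∈ fccSlots, ⟪w, μ⟫_ℝ = 0 ∨ ⟪w, μ⟫_ℝ = Real.sqrt (2 / 3) ∨ ⟪w, μ⟫_ℝ = -Real.sqrt (2 / 3))
    (hβ : ∀ μ ∈ β, ‖μ‖ = 1 ∧
      ∀ w ∈ fccSlots, ⟪w, μ⟫_ℝ = 0 ∨ ⟪w, μ⟫_ℝ = Real.sqrt (2 / 3) ∨ ⟪w, μ⟫_ℝ = -Real.sqrt (2 / 3))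
    (hco : ∃ (L : EuclideanSpace ℝ (Fin 3) ≃ₗᵢ[ℝ] EuclideanSpace ℝ (Fin 3))
        (s₁ s₂ : EuclideanSpace ℝ (Fin 3)) (σ σ' : ℤ → ℤ), IsHaggSeq σ ∧ IsHaggSeq σ' ∧
        F₁ '' fccStacking 1 (Real.sqrt (2 / 3)) ⊆ (fun p => L p + s₁) '' barlowStacking 1 (Real.sqrt (2 / 3)) σ ∧
        F₂ '' fccStacking 1 (Real.sqrt (2 / 3)) ⊆ (fun p => L p + s₂) '' barlowStacking 1 (Real.sqrt (2 / 3)) σ') :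
    ∃ κ : List (EuclideanSpace ℝ (Fin 3)),
      (∀ μ ∈ κ, ‖μ‖ = 1 ∧
        ∀ w ∈ fccSlots, ⟪w, μ⟫_ℝ = 0 ∨ ⟪w, μ⟫_ℝ = Real.sqrt (2 / 3) ∨ ⟪w, μ⟫_ℝ = -Real.sqrt (2 / 3)) ∧
      List.IsChain (fun μ μ' => ⟪μ, μ'⟫_ℝ = 1 / 3 ∨ ⟪μ, μ'⟫_ℝ = -1 / 3) κ ∧
      κ.length ≤ α.length + β.length + 1 ∧
      A₂ '' fccStacking 1 (Real.sqrt (2 / 3)) = (wordFrame A₁ κ) '' fccStacking 1 (Real.sqrt (2 / 3)) := by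
  obtain ⟨S, γ, j, -, hγ, hj, hγjl, -, himg⟩ := exists_word_of_coaxial_wordFrames hF₁ hF₂ hβ hco
  have hl : ∀ μ ∈ γ ++ j ++ α, ‖μ‖ = 1 ∧
      ∀ w ∈ fccSlots, ⟪w, μ⟫_ℝ = 0 ∨ ⟪w, μ⟫_ℝ = Real.sqrt (2 / 3) ∨ ⟪w, μ⟫_ℝ = -Real.sqrt (2 / 3) := by
    intro μ hμ
    rcases List.mem_append.1 hμ with h | h
    · exact hγjl μ h
    · exact hα μ h
  obtain ⟨κ, hsub, hlen, hch, hfr⟩ := exists_reduced_word A₁ (γ ++ j ++ α) hl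
  have hjlen : j.length ≤ 1 := by
    rcases hj with rfl | ⟨m, -, -, rfl⟩ <;> simp
  have hγlen : γ.length = β.length := by rw [hγ, List.length_map, List.length_reverse]
  refine ⟨κ, fun μ hμ => hl μ (hsub μ hμ), hch, ?_, by rw [hfr]; exact himg⟩
  rw [List.length_append, List.length_append] at hlen
  omega

/-- **Level bookkeeping.**  A co-axial coincidence between level `k₁` of a forced ray of grain 1 and level `k₂` of a
forced ray of grain 2 (first push normals unit menu normals of the bases) relates the bases by a reduced admissible word
of length `≤ k₁ + k₂ + 3` — the pair is at most `Σ3^(k₁+k₂+3)`-related. -/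
theorem exists_reduced_word_of_coaxial_levels {z₁ z₂ : EuclideanSpace ℝ (Fin 3)}
    {A₁ A₂ : EuclideanSpace ℝ (Fin 3) ≃ₗᵢ[ℝ] EuclideanSpace ℝ (Fin 3)} {u₁ u₂ n₁ n₂ : EuclideanSpace ℝ (Fin 3)}
    (hn₁ : ‖n₁‖ = 1)
    (hmenu₁ : ∀ w ∈ fccSlots, ⟪A₁ w, n₁⟫_ℝ = 0 ∨ ⟪A₁ w, n₁⟫_ℝ = Real.sqrt (2 / 3) ∨ ⟪A₁ w, n₁⟫_ℝ = -Real.sqrt (2 / 3))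
    (hn₂ : ‖n₂‖ = 1)
    (hmenu₂ : ∀ w ∈ fccSlots, ⟪A₂ w, n₂⟫_ℝ = 0 ∨ ⟪A₂ w, n₂⟫_ℝ = Real.sqrt (2 / 3) ∨ ⟪A₂ w, n₂⟫_ℝ = -Real.sqrt (2 / 3))
    (k₁ k₂ : ℕ)
    (hco : ∃ (L : EuclideanSpace ℝ (Fin 3) ≃ₗᵢ[ℝ] EuclideanSpace ℝ (Fin 3))
        (s₁ s₂ : EuclideanSpace ℝ (Fin 3)) (σ σ' : ℤ → ℤ), IsHaggSeq σ ∧ IsHaggSeq σ' ∧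
        (forcedTop z₁ ⟨A₁, u₁, 0⟩ n₁ k₁).frame '' fccStacking 1 (Real.sqrt (2 / 3)) ⊆
          (fun p => L p + s₁) '' barlowStacking 1 (Real.sqrt (2 / 3)) σ ∧
        (forcedTop z₂ ⟨A₂, u₂, 0⟩ n₂ k₂).frame '' fccStacking 1 (Real.sqrt (2 / 3)) ⊆
          (fun p => L p + s₂) '' barlowStacking 1 (Real.sqrt (2 / 3)) σ') :
    ∃ κ : List (EuclideanSpace ℝ (Fin 3)),
      (∀ μ ∈ κ, ‖μ‖ = 1 ∧
        ∀ w ∈ fccSlots, ⟪w, μ⟫_ℝ = 0 ∨ ⟪w, μ⟫_ℝ = Real.sqrt (2 / 3) ∨ ⟪w, μ⟫_ℝ = -Real.sqrt (2 / 3)) ∧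
      List.IsChain (fun μ μ' => ⟪μ, μ'⟫_ℝ = 1 / 3 ∨ ⟪μ, μ'⟫_ℝ = -1 / 3) κ ∧
      κ.length ≤ k₁ + k₂ + 3 ∧
      A₂ '' fccStacking 1 (Real.sqrt (2 / 3)) = (wordFrame A₁ κ) '' fccStacking 1 (Real.sqrt (2 / 3)) := by
  obtain ⟨κ, hκl, hκc, hlen, himg⟩ := exists_reduced_word_of_coaxial_wordFrames_length
    (forcedTop_frame_eq_wordFrame z₁ ⟨A₁, u₁, 0⟩ hn₁ hmenu₁ k₁)
    (forcedTop_frame_eq_wordFrame z₂ ⟨A₂, u₂, 0⟩ hn₂ hmenu₂ k₂)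
    (rayWord_letters z₁ ⟨A₁, u₁, 0⟩ hn₁ hmenu₁ k₁).1 (rayWord_letters z₂ ⟨A₂, u₂, 0⟩ hn₂ hmenu₂ k₂).1 hco
  refine ⟨κ, hκl, hκc, ?_, himg⟩
  rw [length_rayWord, length_rayWord] at hlen
  omega

/-- Level bookkeeping, the base of grain 1 against level `k₂` of grain 2: `|κ| ≤ k₂ + 2` (at most `Σ3^(k₂+2)`). -/
theorem exists_reduced_word_of_coaxial_base_left {z₂ : EuclideanSpace ℝ (Fin 3)}
    {A₁ A₂ : EuclideanSpace ℝ (Fin 3) ≃ₗᵢ[ℝ] EuclideanSpace ℝ (Fin 3)} {u₂ n₂ : EuclideanSpace ℝ (Fin 3)}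
    (hn₂ : ‖n₂‖ = 1)
    (hmenu₂ : ∀ w ∈ fccSlots, ⟪A₂ w, n₂⟫_ℝ = 0 ∨ ⟪A₂ w, n₂⟫_ℝ = Real.sqrt (2 / 3) ∨ ⟪A₂ w, n₂⟫_ℝ = -Real.sqrt (2 / 3))
    (k₂ : ℕ)
    (hco : ∃ (L : EuclideanSpace ℝ (Fin 3) ≃ₗᵢ[ℝ] EuclideanSpace ℝ (Fin 3))
        (s₁ s₂ : EuclideanSpace ℝ (Fin 3)) (σ σ' : ℤ → ℤ), IsHaggSeq σ ∧ IsHaggSeq σ' ∧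
        A₁ '' fccStacking 1 (Real.sqrt (2 / 3)) ⊆ (fun p => L p + s₁) '' barlowStacking 1 (Real.sqrt (2 / 3)) σ ∧
        (forcedTop z₂ ⟨A₂, u₂, 0⟩ n₂ k₂).frame '' fccStacking 1 (Real.sqrt (2 / 3)) ⊆
          (fun p => L p + s₂) '' barlowStacking 1 (Real.sqrt (2 / 3)) σ') :
    ∃ κ : List (EuclideanSpace ℝ (Fin 3)),
      (∀ μ ∈ κ, ‖μ‖ = 1 ∧
        ∀ w ∈ fccSlots, ⟪w, μ⟫_ℝ = 0 ∨ ⟪w, μ⟫_ℝ = Real.sqrt (2 / 3) ∨ ⟪w, μ⟫_ℝ = -Real.sqrt (2 / 3)) ∧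
      List.IsChain (fun μ μ' => ⟪μ, μ'⟫_ℝ = 1 / 3 ∨ ⟪μ, μ'⟫_ℝ = -1 / 3) κ ∧
      κ.length ≤ k₂ + 2 ∧
      A₂ '' fccStacking 1 (Real.sqrt (2 / 3)) = (wordFrame A₁ κ) '' fccStacking 1 (Real.sqrt (2 / 3)) := by
  obtain ⟨κ, hκl, hκc, hlen, himg⟩ := exists_reduced_word_of_coaxial_wordFrames_length
    (show A₁ = wordFrame A₁ [] from rfl) (forcedTop_frame_eq_wordFrame z₂ ⟨A₂, u₂, 0⟩ hn₂ hmenu₂ k₂)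
    (fun μ hμ => by simp at hμ) (rayWord_letters z₂ ⟨A₂, u₂, 0⟩ hn₂ hmenu₂ k₂).1 hco
  refine ⟨κ, hκl, hκc, ?_, himg⟩
  rw [List.length_nil, length_rayWord] at hlen
  omega

/-- Level bookkeeping, level `k₁` of grain 1 against the base of grain 2: `|κ| ≤ k₁ + 2` (at most `Σ3^(k₁+2)`). -/
theorem exists_reduced_word_of_coaxial_base_right {z₁ : EuclideanSpace ℝ (Fin 3)}
    {A₁ A₂ : EuclideanSpace ℝ (Fin 3) ≃ₗᵢ[ℝ] EuclideanSpace ℝ (Fin 3)} {u₁ n₁ : EuclideanSpace ℝ (Fin 3)}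
    (hn₁ : ‖n₁‖ = 1)
    (hmenu₁ : ∀ w ∈ fccSlots, ⟪A₁ w, n₁⟫_ℝ = 0 ∨ ⟪A₁ w, n₁⟫_ℝ = Real.sqrt (2 / 3) ∨ ⟪A₁ w, n₁⟫_ℝ = -Real.sqrt (2 / 3))
    (k₁ : ℕ)
    (hco : ∃ (L : EuclideanSpace ℝ (Fin 3) ≃ₗᵢ[ℝ] EuclideanSpace ℝ (Fin 3))
        (s₁ s₂ : EuclideanSpace ℝ (Fin 3)) (σ σ' : ℤ → ℤ), IsHaggSeq σ ∧ IsHaggSeq σ' ∧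
        (forcedTop z₁ ⟨A₁, u₁, 0⟩ n₁ k₁).frame '' fccStacking 1 (Real.sqrt (2 / 3)) ⊆
          (fun p => L p + s₁) '' barlowStacking 1 (Real.sqrt (2 / 3)) σ ∧
        A₂ '' fccStacking 1 (Real.sqrt (2 / 3)) ⊆ (fun p => L p + s₂) '' barlowStacking 1 (Real.sqrt (2 / 3)) σ') :
    ∃ κ : List (EuclideanSpace ℝ (Fin 3)),
      (∀ μ ∈ κ, ‖μ‖ = 1 ∧
        ∀ w ∈ fccSlots, ⟪w, μ⟫_ℝ = 0 ∨ ⟪w, μ⟫_ℝ = Real.sqrt (2 / 3) ∨ ⟪w, μ⟫_ℝ = -Real.sqrt (2 / 3)) ∧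
      List.IsChain (fun μ μ' => ⟪μ, μ'⟫_ℝ = 1 / 3 ∨ ⟪μ, μ'⟫_ℝ = -1 / 3) κ ∧
      κ.length ≤ k₁ + 2 ∧
      A₂ '' fccStacking 1 (Real.sqrt (2 / 3)) = (wordFrame A₁ κ) '' fccStacking 1 (Real.sqrt (2 / 3)) := by
  obtain ⟨κ, hκl, hκc, hlen, himg⟩ := exists_reduced_word_of_coaxial_wordFrames_length
    (forcedTop_frame_eq_wordFrame z₁ ⟨A₁, u₁, 0⟩ hn₁ hmenu₁ k₁) (show A₂ = wordFrame A₂ [] from rfl)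
    (rayWord_letters z₁ ⟨A₁, u₁, 0⟩ hn₁ hmenu₁ k₁).1 (fun μ hμ => by simp at hμ) hco
  refine ⟨κ, hκl, hκc, ?_, himg⟩
  rw [List.length_nil, length_rayWord] at hlen
  omega

end Summit.Ventures.Crystal3D.Theorems

end
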